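import Summits.ResolutionOfSingularities.ResolutionOfSingularities.Theorems.ValuativeTorsorToLurelFfiniteFrobenius
import Literature.AlgebraicGeometry.Resolution.InseparableLocalUniformization
import Mathlib.FieldTheory.Perfect

/-!
# `TorsorToLurelPerfect`: the Frobenius-pushed chart from Temkin's theorem over a perfect field

Routes `ResolutionOfSingularities/ShadowGame`, `…/FrobeniusClosing` (and the other routes sharing
the crux `TorsorToLurelPerfect`, stmt-ResolutionOfSingularities-16162), line `temkin-leaf`, stub
`stub_perfectChartOfTemkin`. Helper file.

From the corrected relative form `Temkin2013Relative` of Temkin's inseparable local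
uniformization theorem (Temkin 2013 = arXiv:0804.1554v3, Thm. 1.3.2) we produce, for a PERFECT
ground field `k` of characteristic `p`, `K/k` finitely generated, a valuation ring `O ⊇ k` of `K`
and a finitely generated `k`-subalgebra `R ⊆ O`, the *Frobenius-pushed chart* of Rem. 1.3.5 (i):
an exponent `m` and a finitely generated `k`-subalgebra `A₀ ⊆ O`, regular at the centre of `O`,
with `R^{p^m} ⊆ A₀` and `K^{p^m} ⊆ k(A₀)`.

Proof: steps 0–2 of `torsorToLurelFfinite_of_temkin2013Relative`
(`ValuativeTorsorToLurelFfinite.lean`) verbatim — enlarge `R` to an affine model `R'`, apply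
Thm. 1.3.2 (`L/K` finite purely inseparable, `N = Nr_L(A')` regular at the centre of `O'`), push
`N` into `K` by `ρ x = x^{pⁿ}` (`n` = the exponent of `L/K`) — plus the one new remark that for a
perfect `k` the base field `k^{pⁿ} ≤ K` of `ρ(N)` IS the image of `k` (Frobenius is surjective on
`k`), so `ρ(N)` is a `k`-subalgebra, finitely generated over `k`, and `k(ρ N) ∋ x^{pⁿ}` for all
`x ∈ K` because `Frac N = L`.
-/

noncomputable section

set_option linter.dupNamespace false -- mandated namespace of this single-conjunct summit

open IsLocalRing
open Literature.AlgebraicGeometry.Resolution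

namespace Summit.ResolutionOfSingularities.ResolutionOfSingularities.Theorems

/-- **Temkin's theorem ⇒ the Frobenius-pushed chart over a perfect ground field** (Temkin 2013,
Thm. 1.3.2 and Rem. 1.3.5 (i), at `[k : k^p] = 1`). Assuming the corrected relative form
`Temkin2013Relative` of Thm. 1.3.2: for `k` perfect of characteristic `p`, `K/k` finitely
generated, `O` a valuation ring of `K` containing `k` and `R ⊆ O` a finitely generated
`k`-subalgebra, there are `m : ℕ` and a finitely generated `k`-subalgebra `A₀ ⊆ O`, regular at the
centre `𝔪_O ∩ A₀`, such that `r^{p^m} ∈ A₀` for every `r ∈ R` and `x^{p^m} ∈ k(A₀)` for every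
`x ∈ K`. (Here `A₀ = ρ(Nr_L(A'))` with `ρ x = x^{p^m}` the Frobenius of the purely inseparable
uniformizing extension `L/K`, and `m` its exponent.) -/
theorem stub_perfectChartOfTemkin :
    Literature.AlgebraicGeometry.Resolution.Temkin2013Relative.{0} →
    ∀ p : ℕ, p.Prime → ∀ (k K : Type) [Field k] [CharP k p] [PerfectField k] [Field K] [Algebra k K],
      (⊤ : IntermediateField k K).FG → ∀ O : ValuationSubring K, (∀ c : k, algebraMap k K c ∈ O) →
      ∀ R : Subalgebra k K, R.FG → R.toSubring ≤ O.toSubring →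
      ∃ (m : ℕ) (A₀ : Subalgebra k K) (h₀ : A₀.toSubring ≤ O.toSubring), A₀.FG ∧
        (∀ r ∈ R, r ^ p ^ m ∈ A₀) ∧
        (∀ x : K, x ^ p ^ m ∈ IntermediateField.adjoin k (A₀ : Set K)) ∧
        IsRegularLocalRing (Localization.AtPrime
          (Ideal.comap (Subring.inclusion h₀) (IsLocalRing.maximalIdeal O))) := by
  intro hTem p hp k K _ _ _ _ _ hfg O hO R hRfg hRO
  classical
  haveI : Fact p.Prime := ⟨hp⟩
  -- Step 0: enlarge `R` to an affine model `R'` of `K°`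
  obtain ⟨Am, hAmO, ⟨SA, rfl⟩, hAmfr⟩ := exists_affineModel k K hfg O hO
  obtain ⟨SR, rfl⟩ := hRfg
  let Oalg : Subalgebra k K := { O.toSubring with algebraMap_mem' := hO }
  let R' : Subalgebra k K := Algebra.adjoin k ((SR ∪ SA : Finset K) : Set K)
  have hRR' : Algebra.adjoin k (SR : Set K) ≤ R' :=
    Algebra.adjoin_mono (by rw [Finset.coe_union]; exact Set.subset_union_left)
  have hAmR' : Algebra.adjoin k (SA : Set K) ≤ R' :=
    Algebra.adjoin_mono (by rw [Finset.coe_union]; exact Set.subset_union_right)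
  have hR'O : R'.toSubring ≤ O.toSubring := by
    have hle : R' ≤ Oalg := Algebra.adjoin_le (by
      rw [Finset.coe_union]
      rintro x (hx | hx)
      · exact hRO (Algebra.subset_adjoin hx)
      · exact hAmO (Algebra.subset_adjoin hx))
    exact fun x hx => hle hx
  have hR'fg : R'.FG := ⟨_, rfl⟩
  haveI hR'fr : IsFractionRing R' K := by
    refine IsFractionRing.of_field R' K fun z => ?_
    obtain ⟨a, b, -, rfl⟩ := IsFractionRing.div_surjective (A := Algebra.adjoin k (SA : Set K)) z
    exact ⟨⟨a, hAmR' a.2⟩, ⟨b, hAmR' b.2⟩, rfl⟩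
  -- Step 1: Temkin's theorem
  obtain ⟨L, iF, iA, iA', iT, hfin, hpi, l, -, -, A', hR'A', -, -, -, O', hO', N, hN, hNint, hNfg,
    hNfr, -, -, hNreg⟩ := hTem k K hfg O hO R' hR'O hR'fg hR'fr
  -- Step 2: Frobenius transport of the chart `N`
  haveI : CharP K p := (Algebra.charP_iff k K p).mp inferInstance
  set n : ℕ := IsPurelyInseparable.exponent K L with hn
  set ρ : L →+* K := IsPurelyInseparable.iterateFrobenius K L p (le_refl n) with hρ
  set F : Subfield K := ((algebraMap k K).comp (iterateFrobenius k p n)).fieldRange with hFdef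
  have hO'eq : O.comap ρ = O' := comap_iterateFrobenius_eq p (le_refl n) O O' hO'
  subst hO'eq
  obtain ⟨A₀F, hA₀, hA₀fg⟩ :=
    exists_subalgebra_frobeniusBaseField (le_refl n) (N.restrictScalars k) hNfg
  have hA₀' : N.toSubring.map ρ = A₀F.toSubring := hA₀.symm
  -- `k` perfect: the base field `k^{pⁿ}` of `ρ(N)` is the whole image of `k`
  have hFk : ∀ c : k, algebraMap k K c ∈ F := fun c => by
    obtain ⟨a, ha⟩ := (bijective_iterateFrobenius k p n).2 c
    exact RingHom.mem_fieldRange.mpr ⟨a, by rw [RingHom.comp_apply, ha]⟩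
  -- so `ρ(N)` is a `k`-subalgebra of `K`
  let A₀ : Subalgebra k K :=
    { A₀F.toSubring with
      algebraMap_mem' := fun c => A₀F.algebraMap_mem ⟨_, hFk c⟩ }
  have h₀ : A₀.toSubring ≤ O.toSubring := by
    change A₀F.toSubring ≤ O.toSubring
    rw [← hA₀']
    exact map_iterateFrobenius_le p (le_refl n) O N.toSubring hN
  have hreg₀ : IsRegularLocalRing (Localization.AtPrime
      (Ideal.comap (Subring.inclusion h₀) (maximalIdeal O))) :=
    (isRegularLocalRing_centre_map_iterateFrobenius p (le_refl n) O N.toSubring hN A₀.toSubring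
      hA₀' h₀).mp hNreg
  -- `ρ(N)` is finitely generated over `k`: `k^{pⁿ}[T] = k[T]` inside `K`
  have hA₀fg' : A₀.FG := by
    obtain ⟨T, hT⟩ := hA₀fg
    refine ⟨T, le_antisymm (Algebra.adjoin_le fun t ht => ?_) fun x hx => ?_⟩
    · change t ∈ A₀F
      rw [← hT]
      exact Algebra.subset_adjoin ht
    · change x ∈ A₀F at hx
      rw [← hT] at hx
      let C : Subalgebra F K :=
        { (Algebra.adjoin k (T : Set K)).toSubring with
          algebraMap_mem' := fun c => by
            obtain ⟨a, ha⟩ := frobeniusBaseField_le_range c.2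
            change (c : K) ∈ Algebra.adjoin k (T : Set K)
            rw [← ha]
            exact (Algebra.adjoin k (T : Set K)).algebraMap_mem a }
      have hle : Algebra.adjoin F (T : Set K) ≤ C := Algebra.adjoin_le Algebra.subset_adjoin
      exact hle hx
  -- `R'^{pⁿ} ⊆ ρ(N)` since `R' ⊆ A' ⊆ Nr_L(A') = N`
  have hR'pow : ∀ x ∈ R', x ^ p ^ n ∈ A₀ := by
    intro x hx
    have hxN : algebraMap K L x ∈ N.toSubring := by
      change algebraMap K L x ∈ N
      rw [← SetLike.mem_coe, hNint]
      have hmem : algebraMap K L x ∈ A'.map (IsScalarTower.toAlgHom k K L) :=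
        Subalgebra.mem_map.mpr ⟨x, hR'A' hx, rfl⟩
      exact (isIntegral_algebraMap (R := ↥(A'.map (IsScalarTower.toAlgHom k K L)))
        (A := L) (x := ⟨_, hmem⟩))
    have h := pow_mem_of_algebraMap_mem p (le_refl n) N.toSubring x hxN
    rw [hA₀'] at h
    exact h
  -- `K^{pⁿ} ⊆ k(ρ(N))` since `Frac N = L`
  have hNfr' : ∀ y : L, ∃ a ∈ N.toSubring, ∃ b ∈ N.toSubring, y = a / b := fun y => by
    obtain ⟨a, b, -, rfl⟩ := IsFractionRing.div_surjective (A := N) y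
    exact ⟨a, a.2, b, b.2, rfl⟩
  have hρN : ∀ a ∈ N.toSubring, ρ a ∈ A₀ := fun a ha => by
    have h : ρ a ∈ N.toSubring.map ρ := ⟨a, ha, rfl⟩
    rw [hA₀'] at h
    exact h
  have hKp : ∀ x : K, x ^ p ^ n ∈ IntermediateField.adjoin k (A₀ : Set K) := fun x => by
    obtain ⟨a, ha, b, hb, hab⟩ := hNfr' (algebraMap K L x)
    have hx : x ^ p ^ n = ρ a / ρ b := by
      rw [← IsPurelyInseparable.iterateFrobenius_algebraMap L p (le_refl n) x, hab, map_div₀]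
    rw [hx]
    exact div_mem (IntermediateField.subset_adjoin k _ (hρN a ha))
      (IntermediateField.subset_adjoin k _ (hρN b hb))
  exact ⟨n, A₀, h₀, hA₀fg', fun r hr => hR'pow r (hRR' hr), hKp, hreg₀⟩

end Summit.ResolutionOfSingularities.ResolutionOfSingularities.Theorems

end
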